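import Mathlib
import Literature.MathematicalPhysics.QuantumLattice.EuclideanAction
import Literature.MathematicalPhysics.QuantumLattice.SchwartzTensor
import Literature.MathematicalPhysics.QuantumLattice.SchwartzLocalDensity
import HarnessLib

/-!
# `NPointIsotropy` — degree one of the finite harmonic kill (support for stmt-QuantumFields-11686)

Support file for crux `stmt-QuantumFields-11686` (`PencilRigidity.NPointIsotropy`), line
`complex-rotation-bandlimit`, sub-goal `translationInvariant_degreeOne` of the lead's stub
`stub_harmonicKill` (its degree `n = 1`).

**Statement.** A continuous linear functional `S` on `𝓢((Fin 1 → ℝ⁴), ℂ)` which is invariant under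
all translations `F ↦ F(· - a)` and which is represented by a FUNCTION `W` (`S F = ∫ W·F` with `W·F`
integrable for every Schwartz `F`) is a constant multiple of Lebesgue measure: `S F = c ∫ F`.

**Route (no mollifier limit).** For compactly supported Schwartz `φ, ψ` consider the absolutely
convergent double integral `∫∫ W x · φ(x - y) · ψ(y) dy dx` (dominated by `|W·g|(x) ‖φ‖∞ |ψ(y)|` with
`g` a bump equal to `1` on `supp ψ + supp φ`; `W·g` is integrable by the function residual). Doing
the `x`-integral first gives `S(φ(· - y)) = S φ` (translation invariance), whence the value
`S φ · ∫ ψ`; the substitution `y ↦ x - y` (Lebesgue measure is invariant) turns the inner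
`y`-integral into `∫ ψ(x - y) φ(y) dy`, so the same computation with the roles exchanged gives
`S ψ · ∫ φ`. Hence `S φ ∫ ψ = S ψ ∫ φ`; with `∫ φ₀ = 1` this is `S ψ = S φ₀ · ∫ ψ` for every compactly
supported `ψ`, and the compactly supported cutoffs `χ(x/m) F → F` in `𝓢` (tree lemma
`exists_cutoff_seq`) plus dominated convergence extend it to all of `𝓢`. [folklore]
-/

noncomputable section

open scoped BigOperators SchwartzMap
open MeasureTheory Filter Topology
open Literature.MathematicalPhysics.QuantumLattice

namespace Summit.QuantumFields.YangMills.Theorems.NPointIsotropy.ComplexRotationBandlimit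

local notation "X1" => Fin 1 → EuclideanSpace ℝ (Fin 4)

namespace DegreeOne

/-! ## Instances on `Fin 1 → ℝ⁴` that instance search does not find by itself -/

/-- Lebesgue measure on `Fin 1 → ℝ⁴` has temperate growth. [folklore] -/
theorem hasTemperateGrowth_volume_X1 : (volume : Measure X1).HasTemperateGrowth :=
  Measure.IsAddHaarMeasure.instHasTemperateGrowth

/-- Lebesgue measure on `Fin 1 → ℝ⁴` is invariant under `x ↦ -x`. [folklore] -/
theorem isNegInvariant_volume_X1 : (volume : Measure X1).IsNegInvariant :=
  haveI : (volume : Measure X1).Regular := Measure.Regular.of_sigmaCompactSpace_of_isLocallyFiniteMeasure _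
  Measure.IsAddHaarMeasure.isNegInvariant_of_regular _

/-! ## Translation invariance read on the representing function -/

/-- On `Fin 1 → E` the diagonal translation by `y 0` is the translation by `y`. [folklore] -/
theorem translateMulti_apply_fin_one (y : X1) (φ : 𝓢(X1, ℂ)) (x : X1) :
    translateMulti (y 0) φ x = φ (x - y) := by
  rw [translateMulti_apply]
  congr 1
  funext i
  rw [Subsingleton.elim i 0]
  rfl

/-- Translation invariance plus the function residual: `∫ W x · φ(x - y) dx = S φ` for every `y`,
with an integrable integrand. [folklore] -/
theorem integral_mul_translate_eq {S : 𝓢(X1, ℂ) →L[ℂ] ℂ} {W : X1 → ℂ}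
    (hT : ∀ (a : EuclideanSpace ℝ (Fin 4)) (F : 𝓢(X1, ℂ)), S (translateMulti a F) = S F)
    (hW : ∀ F : 𝓢(X1, ℂ), Integrable (fun x : X1 => W x * F x) ∧ S F = ∫ x : X1, W x * F x)
    (φ : 𝓢(X1, ℂ)) (y : X1) :
    Integrable (fun x : X1 => W x * φ (x - y)) ∧ ∫ x : X1, W x * φ (x - y) = S φ := by
  have hfun : (fun x : X1 => W x * translateMulti (y 0) φ x) = fun x : X1 => W x * φ (x - y) := by
    funext x
    rw [translateMulti_apply_fin_one]
  obtain ⟨hi, hS⟩ := hW (translateMulti (y 0) φ)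
  rw [hfun] at hi hS
  exact ⟨hi, by rw [← hS, hT]⟩

/-! ## The double integral -/

/-- **Key computation.** For compactly supported Schwartz `φ, ψ`:
`∫ W x (∫ φ(x - y) ψ(y) dy) dx = S φ · ∫ ψ` (Fubini, then translation invariance in `x`). [folklore] -/
theorem integral_mul_integral_eq {S : 𝓢(X1, ℂ) →L[ℂ] ℂ} {W : X1 → ℂ}
    (hT : ∀ (a : EuclideanSpace ℝ (Fin 4)) (F : 𝓢(X1, ℂ)), S (translateMulti a F) = S F)
    (hW : ∀ F : 𝓢(X1, ℂ), Integrable (fun x : X1 => W x * F x) ∧ S F = ∫ x : X1, W x * F x)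
    (φ ψ : 𝓢(X1, ℂ)) (hφ : HasCompactSupport (φ : X1 → ℂ)) (hψ : HasCompactSupport (ψ : X1 → ℂ)) :
    ∫ x : X1, W x * ∫ y : X1, φ (x - y) * ψ y = S φ * ∫ y : X1, ψ y := by
  haveI : (volume : Measure X1).HasTemperateGrowth := hasTemperateGrowth_volume_X1
  -- a common radius for the two supports
  obtain ⟨R, hR⟩ := (hφ.isCompact.union hψ.isCompact).isBounded.subset_closedBall (0 : X1)
  -- a bump equal to one on `closedBall 0 (2|R|+1) ⊇ supp ψ + supp φ`
  let χ : ContDiffBump (0 : X1) := ⟨2 * |R| + 1, 2 * |R| + 2, by positivity, by linarith⟩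
  have hχ1 : ∀ x y : X1, φ (x - y) * ψ y ≠ 0 → (χ : X1 → ℝ) x = 1 := by
    intro x y h
    have hy : y ∈ tsupport (ψ : X1 → ℂ) := subset_tsupport _ (right_ne_zero_of_mul h)
    have hxy : x - y ∈ tsupport (φ : X1 → ℂ) := subset_tsupport _ (left_ne_zero_of_mul h)
    have h1 : ‖y‖ ≤ |R| := (mem_closedBall_zero_iff.1 (hR (Or.inr hy))).trans (le_abs_self R)
    have h2 : ‖x - y‖ ≤ |R| := (mem_closedBall_zero_iff.1 (hR (Or.inl hxy))).trans (le_abs_self R)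
    apply χ.one_of_mem_closedBall
    rw [mem_closedBall_zero_iff]
    calc ‖x‖ = ‖(x - y) + y‖ := by rw [sub_add_cancel]
      _ ≤ ‖x - y‖ + ‖y‖ := norm_add_le _ _
      _ ≤ 2 * |R| + 1 := by linarith
  have hgc : HasCompactSupport (fun x : X1 => ((χ : X1 → ℝ) x : ℂ)) :=
    χ.hasCompactSupport.comp_left Complex.ofReal_zero
  have hgs : ContDiff ℝ (⊤ : ℕ∞) (fun x : X1 => ((χ : X1 → ℝ) x : ℂ)) :=
    Complex.ofRealCLM.contDiff.comp χ.contDiff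
  let g : 𝓢(X1, ℂ) := hgc.toSchwartzMap hgs
  have hg_apply : ∀ x : X1, g x = ((χ : X1 → ℝ) x : ℂ) := fun x => rfl
  have hpt : ∀ x y : X1, W x * (φ (x - y) * ψ y) = (W x * g x) * (φ (x - y) * ψ y) := by
    intro x y
    by_cases h : φ (x - y) * ψ y = 0
    · simp [h]
    · rw [hg_apply, hχ1 x y h]
      push_cast
      ring
  -- integrability on the product
  obtain ⟨C, hC⟩ := hφ.exists_bound_of_continuous φ.continuous
  have hWg : Integrable (fun x : X1 => W x * g x) := (hW g).1
  have hint : Integrable (Function.uncurry fun x y : X1 => W x * (φ (x - y) * ψ y))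
      ((volume : Measure X1).prod volume) := by
    have hdom : Integrable (fun p : X1 × X1 => ‖W p.1 * g p.1‖ * (C * ‖ψ p.2‖))
        ((volume : Measure X1).prod volume) :=
      hWg.norm.mul_prod (ψ.integrable.norm.const_mul C)
    refine hdom.mono' ?_ (ae_of_all _ fun p => ?_)
    · have h1 : AEStronglyMeasurable (fun p : X1 × X1 => W p.1 * g p.1)
          ((volume : Measure X1).prod volume) := hWg.aestronglyMeasurable.comp_fst
      have h2 : Continuous (fun p : X1 × X1 => φ (p.1 - p.2) * ψ p.2) := by fun_prop
      refine (h1.mul h2.aestronglyMeasurable).congr (ae_of_all _ fun p => ?_)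
      exact (hpt p.1 p.2).symm
    · change ‖W p.1 * (φ (p.1 - p.2) * ψ p.2)‖ ≤ ‖W p.1 * g p.1‖ * (C * ‖ψ p.2‖)
      rw [hpt p.1 p.2, norm_mul, norm_mul (φ _)]
      gcongr
      exact hC _
  -- the `x`-integral first
  have hinner : ∀ y : X1, ∫ x : X1, W x * (φ (x - y) * ψ y) = S φ * ψ y := by
    intro y
    simp_rw [← mul_assoc]
    rw [integral_mul_const, (integral_mul_translate_eq hT hW φ y).2]
  calc ∫ x : X1, W x * ∫ y : X1, φ (x - y) * ψ y
      = ∫ x : X1, ∫ y : X1, W x * (φ (x - y) * ψ y) := by simp_rw [integral_const_mul]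
    _ = ∫ y : X1, ∫ x : X1, W x * (φ (x - y) * ψ y) := integral_integral_swap hint
    _ = ∫ y : X1, S φ * ψ y := by simp_rw [hinner]
    _ = S φ * ∫ y : X1, ψ y := integral_const_mul _ _

/-- **Symmetry.** `S φ · ∫ ψ = S ψ · ∫ φ` for compactly supported Schwartz `φ, ψ`: the inner integral
of `integral_mul_integral_eq` is symmetric under `y ↦ x - y`. [folklore] -/
theorem apply_mul_integral_comm {S : 𝓢(X1, ℂ) →L[ℂ] ℂ} {W : X1 → ℂ}
    (hT : ∀ (a : EuclideanSpace ℝ (Fin 4)) (F : 𝓢(X1, ℂ)), S (translateMulti a F) = S F)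
    (hW : ∀ F : 𝓢(X1, ℂ), Integrable (fun x : X1 => W x * F x) ∧ S F = ∫ x : X1, W x * F x)
    (φ ψ : 𝓢(X1, ℂ)) (hφ : HasCompactSupport (φ : X1 → ℂ)) (hψ : HasCompactSupport (ψ : X1 → ℂ)) :
    S φ * ∫ y : X1, ψ y = S ψ * ∫ y : X1, φ y := by
  haveI : (volume : Measure X1).IsNegInvariant := isNegInvariant_volume_X1
  rw [← integral_mul_integral_eq hT hW φ ψ hφ hψ, ← integral_mul_integral_eq hT hW ψ φ hψ hφ]
  congr 1
  funext x
  congr 1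
  rw [← integral_sub_left_eq_self (fun y : X1 => ψ (x - y) * φ y) volume x]
  congr 1
  funext y
  rw [sub_sub_cancel, mul_comm]

/-- A compactly supported Schwartz function on `Fin 1 → ℝ⁴` with integral one (a normalised bump).
[folklore] -/
theorem exists_hasCompactSupport_integral_eq_one :
    ∃ φ : 𝓢(X1, ℂ), HasCompactSupport (φ : X1 → ℂ) ∧ ∫ x : X1, φ x = 1 := by
  let χ : ContDiffBump (0 : X1) := ⟨1, 2, one_pos, one_lt_two⟩
  have hc : HasCompactSupport (fun x : X1 => ((χ.normed volume x : ℝ) : ℂ)) :=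
    χ.hasCompactSupport_normed.comp_left Complex.ofReal_zero
  have hs : ContDiff ℝ (⊤ : ℕ∞) (fun x : X1 => ((χ.normed volume x : ℝ) : ℂ)) :=
    Complex.ofRealCLM.contDiff.comp χ.contDiff_normed
  refine ⟨hc.toSchwartzMap hs, hc, ?_⟩
  change ∫ x : X1, ((χ.normed volume x : ℝ) : ℂ) = 1
  rw [integral_complex_ofReal, χ.integral_normed]
  simp

end DegreeOne

/-! ## The registered sub-goal -/

/-- **Degree one of the finite harmonic kill.** A translation-invariant continuous linear functional
on `𝓢((Fin 1 → ℝ⁴), ℂ)` represented by a function is a constant multiple of Lebesgue measure.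
[folklore] -/
theorem translationInvariant_degreeOne :
    ∀ (S₁ : Literature.MathematicalPhysics.QuantumLattice.SchwingerFamily (EuclideanSpace ℝ (Fin 4))),
      (∀ (a : EuclideanSpace ℝ (Fin 4)) (F : SchwartzMap (Fin 1 → EuclideanSpace ℝ (Fin 4)) ℂ),
        S₁ 1 (Literature.MathematicalPhysics.QuantumLattice.translateMulti a F) = S₁ 1 F) →
      (∃ W : (Fin 1 → EuclideanSpace ℝ (Fin 4)) → ℂ,
        ∀ F : SchwartzMap (Fin 1 → EuclideanSpace ℝ (Fin 4)) ℂ,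
          MeasureTheory.Integrable (fun x : Fin 1 → EuclideanSpace ℝ (Fin 4) => W x * F x) ∧
            S₁ 1 F = ∫ x : Fin 1 → EuclideanSpace ℝ (Fin 4), W x * F x) →
      ∃ c : ℂ, ∀ F : SchwartzMap (Fin 1 → EuclideanSpace ℝ (Fin 4)) ℂ,
        S₁ 1 F = c * ∫ x : Fin 1 → EuclideanSpace ℝ (Fin 4), F x := by
  intro S₁ hT hres
  obtain ⟨W, hW⟩ := hres
  haveI : (volume : Measure X1).HasTemperateGrowth := DegreeOne.hasTemperateGrowth_volume_X1
  obtain ⟨φ₀, hφ₀c, hφ₀i⟩ := DegreeOne.exists_hasCompactSupport_integral_eq_one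
  refine ⟨S₁ 1 φ₀, fun F => ?_⟩
  -- compactly supported test functions
  have hcs : ∀ ψ : 𝓢(X1, ℂ), HasCompactSupport (ψ : X1 → ℂ) →
      S₁ 1 ψ = S₁ 1 φ₀ * ∫ x : X1, ψ x := by
    intro ψ hψ
    have h := DegreeOne.apply_mul_integral_comm hT hW φ₀ ψ hφ₀c hψ
    rw [hφ₀i, mul_one] at h
    exact h.symm
  -- general test functions: compactly supported cutoffs and dominated convergence
  obtain ⟨u, hu, -, hule, hupt, hlim⟩ := exists_cutoff_seq F
  have h1 : Tendsto (fun m => S₁ 1 (u m)) atTop (𝓝 (S₁ 1 F)) := ((S₁ 1).continuous.tendsto F).comp hlim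
  have h2 : Tendsto (fun m => ∫ x : X1, u m x) atTop (𝓝 (∫ x : X1, F x)) :=
    tendsto_integral_of_dominated_convergence (fun x => ‖F x‖)
      (fun m => (u m).continuous.aestronglyMeasurable) F.integrable.norm
      (fun m => ae_of_all _ (hule m)) (ae_of_all _ hupt)
  have h3 : Tendsto (fun m => S₁ 1 (u m)) atTop (𝓝 (S₁ 1 φ₀ * ∫ x : X1, F x)) := by
    have heq : (fun m => S₁ 1 (u m)) = fun m => S₁ 1 φ₀ * ∫ x : X1, u m x := funext fun m => hcs _ (hu m)
    rw [heq]
    exact h2.const_mul _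
  exact tendsto_nhds_unique h1 h3

end Summit.QuantumFields.YangMills.Theorems.NPointIsotropy.ComplexRotationBandlimit

end
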